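import Literature.Computability.Cryptography.ClassBQP
import HarnessLib

/-!
# The circuit-model quantum time classes `BQTimeUniform t`

Topic `Literature/Computability/QuantumComplexity`; definition request `defn-BQTimeUniform` of
route `CompactnessLift` (summit `QuantumAdvantage`), which stratifies the tree's `BQP`
(`Literature.Computability.Cryptography.BQP`, poly-time uniform oracle-free Clifford+T families,
two-sided error `1/3`) by the **time allowed to generate the circuits**:

* `BQTimeUniform t` — the languages `L ⊆ {0,1}*` decided with two-sided error `≤ 1/3` (accept
  with probability `≥ 2/3` on `x ∈ L`, `≤ 1/3` on `x ∉ L`) by an oracle-free family `F` of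
  Clifford+T circuits whose description map `1ⁿ ↦ sigmaEncode ⟨n, F.ancillas n, F.circ n⟩`
  (binary input count, unary ancilla count, gate list — the output encoder of the tree's
  uniformity condition `QCircuitFamily.IsUniform`) is computable by a TM2 machine within
  *exactly* `t n` steps (`Literature.Computability.Complexity.TimeComputable … t`, no big-O, like
  the tree's `TimeClass t`; the `O(·)`-closure at `t = n ↦ n ^ k` is the union
  `⋃ C, BQTimeUniform (fun n => C * n ^ k + C)`, like the tree's `DTIME`).

This is the circuit-model form of Bernstein–Vazirani's `BQTime(T(n))` ("the set of languages that
are accepted with probability `2/3` by some QTM whose running time on any input of length `n` is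
bounded by `T(n)`", §8.1, the paragraph after Def. 8.1), with Watrous's *polynomial-time generated*
families (§IV.1, Def. 2: "a polynomial-time deterministic Turing machine that, on every input
`x ∈ S`, outputs an encoding of `Q_x`"; `BQP = BQP(2/3, 1/3)`) refined from "polynomial time" to the
explicit bound `t`. Since a TM2 statement pushes boundedly many symbols per step, a family in
`BQTimeUniform t` has descriptions of length `O(t n)`, hence `O(t n)` gates and ancillas.

## API (all proved)

* `mem_BQTimeUniform_iff` (definitional unfolding), `BQTimeUniform_mono` (monotone in `t`);
* `BQTimeUniform_subset_BQP_of_le_eval` — **`BQTimeUniform t ⊆ BQP` for every `t` bounded by a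
  polynomial** (a time-`t` generator is a polynomial-time uniformity witness), with the instances
  `BQTimeUniform_eval_subset_BQP` (`t = p.eval`), `BQTimeUniform_mul_pow_add_subset_BQP`
  (`t = C·nᵏ + C`), `iUnion_BQTimeUniform_mul_pow_add_subset_BQP` (`⋃ C`);
* `BQP_eq_iUnion_BQTimeUniform_eval` — **`BQP = ⋃ₚ BQTimeUniform p`** over `p : Polynomial ℕ`, and
  `BQP_eq_iUnion_BQTimeUniform_pow` — `BQP = ⋃ₖ ⋃_C BQTimeUniform (C·nᵏ + C)` (the quantum twin of
  the tree's `P = ⋃ₖ DTIME(nᵏ)`, via `exists_eval_le_mul_pow_add`);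
* `mem_iUnion_BQTimeUniform_iff`, `setOf_exists_timeComputable_eq_iUnion`,
  `setOf_exists_timeComputable_pow_subset_BQP` — the bridge to the comprehension inlined by route
  `CompactnessLift` (its `QuadQ` is literally the left-hand side at `k = 2`, i.e.
  `⋃ C, BQTimeUniform (fun n => C * n ^ 2 + C)`).

## Design choices

* Gate set, error and oracle are FIXED (Clifford+T `cliffordT`, thresholds `2/3`/`1/3` written as
  in `ClassBQP.mem_BQP_iff`, oracle-free families with the empty oracle `0 : Language Bool`), exactly
  as the requesting route states its items, so that membership unfolds by `Iff.rfl` to the route's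
  text. At a fixed time bound `t` the class is NOT robust under these choices (changing the gate
  set or amplifying the error costs time); robustness only holds for the polynomial closure `BQP`
  (`BQPWith_eq_BQP_holds`, `BQPOver_eq_BQP` in the tree).
* The uniformity clause is the tree's `TimeComputable unaryEncodeNat QCircuit.sigmaEncode` term of
  `QCircuitFamily.IsUniform` with the polynomial replaced by `t` (so `F.IsUniform` is literally
  `∃ p : Polynomial ℕ, <clause at t = p.eval>`); no auxiliary predicate is introduced.
* By the halting rule of the TM2 model (`TimeBounds.lean`: a machine must pop its whole unary
  input `1ⁿ` before halting, boundedly many symbols per step) `BQTimeUniform t` is empty when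
  `t n = o(n)`, as for the tree's `TimeClass`; harmless here (the route uses `t = C·n² + C`).

## What is deliberately NOT here

* The relativized, time-indexed classes `BQTimeRel A t` / `BPTimeRel` (separate request
  `defn-BQTimeRel`).
* The padding lemma "every `L ∈ BQP` pads into `⋃ C, BQTimeUniform (C·n² + C)`" wanted by the route's
  support item `SummitGivesLadder`: it is a statement about explicit quadratic step counts of a TM2
  description generator (re-indexing the ancilla wires of a size-`n^k` circuit onto `N ≥ n^k` input
  wires within `O(N²)` steps), not a printed theorem, and the route itself lists it as the typing
  test of `QuadQ`; it is route content (a `Theorems/` file), not a Literature fact.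
* Error reduction at a fixed `t` (Bernstein–Vazirani 1997, Thm. 8.5 is for QTMs and
  time-constructible `T`); only the polynomial level is in the tree (`BQP_eq_BQPWith_holds`).

## References

* E. Bernstein, U. Vazirani, *Quantum complexity theory*, SIAM J. Comput. 26 (1997) 1411–1473,
  §8.1 (Def. 8.1 and the definition of `BQTime(T(n))` following it) [BernsteinVazirani1997SICOMP].
* J. Watrous, *Quantum computational complexity*, Encyclopedia of Complexity and Systems Science
  (2009), arXiv:0804.3401, §IV.1 (Def. 2, polynomial-time generated families; `BQP(a, b)`)
  [Watrous2009].
* A. C.-C. Yao, *Quantum circuit complexity*, FOCS 1993 (uniform circuit families vs. QTMs)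
  [Yao1993].
* S. Arora, B. Barak, *Computational Complexity: A Modern Approach*, CUP 2009, Def. 1.12–1.13
  (`DTIME`, `P = ⋃ DTIME(n^c)`), §6.2 (uniformly generated circuit families) [AroraBarakCC2009].
-/

namespace Literature.Computability.QuantumComplexity

open _root_.Computability Complexity Cryptography

/-! ### The definition -/

/-- **`BQTimeUniform t`**, the circuit-model `BQTIME(t)`: the languages `L ⊆ {0,1}*` for which some
oracle-free family `F` of Clifford+T circuits, whose description
`1ⁿ ↦ sigmaEncode ⟨n, F.ancillas n, F.circ n⟩` is computable by a TM2 machine within `t n` steps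
(the clause of `QCircuitFamily.IsUniform` with the polynomial replaced by the explicit bound `t`),
accepts every `x ∈ L` with probability `≥ 2/3` and every `x ∉ L` with probability `≤ 1/3`
(acceptance = measuring wire `0` after running `F.circ |x|` on `|x⟩|0…0⟩`, empty oracle).
Bernstein–Vazirani define `BQTime(T(n))` as "the set of languages that are accepted with
probability `2/3` by some QTM whose running time on any input of length `n` is bounded by `T(n)`";
this is its circuit form with Watrous's generated families, the generation time being the resource.
[cite: BernsteinVazirani1997SICOMP, §8.1 (Def. 8.1 ff., BQTime(T(n)))]
[cite: Watrous2009, §IV.1 Def. 2 (polynomial-time generated families), BQP(a,b)] -/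
def BQTimeUniform (t : ℕ → ℕ) : Set (Language Bool) :=
  {L | ∃ F : QCircuitFamily cliffordT, F.IsOracleFree ∧
    TimeComputable unaryEncodeNat (QCircuit.sigmaEncode (G := cliffordT))
      (fun n => (⟨n, F.ancillas n, F.circ n⟩ : Σ n m : ℕ, QCircuit cliffordT (n + m))) t ∧
    ∀ x, (x ∈ L → 2 / 3 ≤ F.acceptProbOn 0 x) ∧ (x ∉ L → F.acceptProbOn 0 x ≤ 1 / 3)}

/-! ### API -/

/-- Unfolding lemma for `BQTimeUniform` (definitional).
[cite: BernsteinVazirani1997SICOMP, §8.1 (BQTime(T(n)))] -/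
theorem mem_BQTimeUniform_iff {t : ℕ → ℕ} {L : Language Bool} :
    L ∈ BQTimeUniform t ↔ ∃ F : QCircuitFamily cliffordT, F.IsOracleFree ∧
      TimeComputable unaryEncodeNat (QCircuit.sigmaEncode (G := cliffordT))
        (fun n => (⟨n, F.ancillas n, F.circ n⟩ : Σ n m : ℕ, QCircuit cliffordT (n + m))) t ∧
      ∀ x, (x ∈ L → 2 / 3 ≤ F.acceptProbOn 0 x) ∧ (x ∉ L → F.acceptProbOn 0 x ≤ 1 / 3) :=
  Iff.rfl

/-- `BQTimeUniform` is monotone in the time bound (a machine halting within `t n` steps halts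
within `t' n ≥ t n` steps, `TimeComputable.mono`). [cite: BernsteinVazirani1997SICOMP, §8.1 (BQTime(T(n)))] -/
theorem BQTimeUniform_mono {t t' : ℕ → ℕ} (h : ∀ n, t n ≤ t' n) :
    BQTimeUniform t ⊆ BQTimeUniform t' := by
  rintro L ⟨F, hF, hT, hL⟩
  exact ⟨F, hF, hT.mono h, hL⟩

/-- A family generated within a polynomially bounded time `t ≤ p` is polynomial-time uniform
(`QCircuitFamily.IsUniform` is `∃ p, TimeComputable … p.eval`). Stated for every gate set.
[cite: Watrous2009, §IV.1 Def. 2 (polynomial-time generated families)] -/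
theorem isUniform_of_timeComputable_le_eval {G : QGateSet} [Encodable G.Op] {F : QCircuitFamily G}
    {t : ℕ → ℕ} (p : Polynomial ℕ) (ht : ∀ n, t n ≤ p.eval n)
    (h : TimeComputable unaryEncodeNat (QCircuit.sigmaEncode (G := G))
      (fun n => (⟨n, F.ancillas n, F.circ n⟩ : Σ n m : ℕ, QCircuit G (n + m))) t) :
    F.IsUniform :=
  ⟨p, h.mono ht⟩

/-- **`BQTimeUniform t ⊆ BQP` whenever `t` is bounded by a polynomial**: the time-`t` generator is
a polynomial-time uniformity witness, and the acceptance thresholds are those of `BQP`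
(`ClassBQP.mem_BQP_iff`). [cite: BernsteinVazirani1997SICOMP, §8.1 (BQP, BQTime(T(n)))] -/
theorem BQTimeUniform_subset_BQP_of_le_eval {t : ℕ → ℕ} (p : Polynomial ℕ)
    (ht : ∀ n, t n ≤ p.eval n) : BQTimeUniform t ⊆ BQP := by
  rintro L ⟨F, hF, hT, hL⟩
  exact ClassBQP.mem_BQP_iff.2 ⟨F, hF, isUniform_of_timeComputable_le_eval p ht hT, hL⟩

/-- `BQTimeUniform p ⊆ BQP` for a polynomial time bound `p`.
[cite: BernsteinVazirani1997SICOMP, §8.1 (BQP, BQTime(T(n)))] -/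
theorem BQTimeUniform_eval_subset_BQP (p : Polynomial ℕ) :
    BQTimeUniform (fun n => p.eval n) ⊆ BQP :=
  BQTimeUniform_subset_BQP_of_le_eval p fun _ => le_rfl

/-- `BQTimeUniform (C·nᵏ + C) ⊆ BQP` (the bound is the polynomial `C·Xᵏ + C`); at `k = 2` this is
the class `QuadQ` of route `CompactnessLift` at one constant `C`.
[cite: BernsteinVazirani1997SICOMP, §8.1 (BQP, BQTime(T(n)))] -/
theorem BQTimeUniform_mul_pow_add_subset_BQP (C k : ℕ) :
    BQTimeUniform (fun n => C * n ^ k + C) ⊆ BQP :=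
  BQTimeUniform_subset_BQP_of_le_eval (Polynomial.C C * Polynomial.X ^ k + Polynomial.C C)
    fun n => by simp

/-- `⋃ C, BQTimeUniform (C·nᵏ + C) ⊆ BQP`: the `O(nᵏ)`-time-uniform Clifford+T languages are in
`BQP`. [cite: BernsteinVazirani1997SICOMP, §8.1 (BQP, BQTime(T(n)))] -/
theorem iUnion_BQTimeUniform_mul_pow_add_subset_BQP (k : ℕ) :
    (⋃ C : ℕ, BQTimeUniform (fun n => C * n ^ k + C)) ⊆ BQP :=
  Set.iUnion_subset fun C => BQTimeUniform_mul_pow_add_subset_BQP C k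

/-- **`BQP` is the polynomial level of the hierarchy**: `BQP = ⋃ₚ BQTimeUniform p` over
`p : Polynomial ℕ` (unfold `QCircuitFamily.IsUniform = PolyTimeComputable … = ∃ p, TimeComputable … p`
and commute the existentials). [cite: BernsteinVazirani1997SICOMP, §8.1 (BQP, BQTime(T(n)))] -/
theorem BQP_eq_iUnion_BQTimeUniform_eval :
    BQP = ⋃ p : Polynomial ℕ, BQTimeUniform (fun n => p.eval n) := by
  ext L
  rw [ClassBQP.mem_BQP_iff, Set.mem_iUnion]
  constructor
  · rintro ⟨F, hF, ⟨p, hp⟩, hL⟩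
    exact ⟨p, F, hF, hp, hL⟩
  · rintro ⟨p, F, hF, hp, hL⟩
    exact ⟨F, hF, ⟨p, hp⟩, hL⟩

/-- **`BQP = ⋃ₖ ⋃_C BQTimeUniform (C·nᵏ + C)`**, the quantum twin of `P = ⋃ₖ DTIME(nᵏ)`: every
polynomial with natural coefficients is dominated by some `C·nᵏ + C`
(`exists_eval_le_mul_pow_add`). [cite: AroraBarakCC2009, Def. 1.13]
[cite: BernsteinVazirani1997SICOMP, §8.1 (BQP, BQTime(T(n)))] -/
theorem BQP_eq_iUnion_BQTimeUniform_pow :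
    BQP = ⋃ k : ℕ, ⋃ C : ℕ, BQTimeUniform (fun n => C * n ^ k + C) := by
  refine Set.Subset.antisymm ?_
    (Set.iUnion_subset fun k => iUnion_BQTimeUniform_mul_pow_add_subset_BQP k)
  intro L hL
  obtain ⟨F, hF, ⟨p, hp⟩, hL⟩ := ClassBQP.mem_BQP_iff.1 hL
  obtain ⟨c, k, hck⟩ := exists_eval_le_mul_pow_add p
  exact Set.mem_iUnion.2 ⟨k, Set.mem_iUnion.2 ⟨c, F, hF, hp.mono hck, hL⟩⟩

/-! ### Bridge to the comprehension inlined by route `CompactnessLift` -/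

/-- Membership in a union `⋃ i, BQTimeUniform (t i)` with the existential over the index moved
inside, next to the uniformity clause (the shape in which route `CompactnessLift` inlines its class
`QuadQ`, `t C = C·n² + C`). [folklore] -/
theorem mem_iUnion_BQTimeUniform_iff {ι : Sort*} {t : ι → ℕ → ℕ} {L : Language Bool} :
    L ∈ (⋃ i, BQTimeUniform (t i)) ↔ ∃ F : QCircuitFamily cliffordT, F.IsOracleFree ∧
      (∃ i, TimeComputable unaryEncodeNat (QCircuit.sigmaEncode (G := cliffordT))
        (fun n => (⟨n, F.ancillas n, F.circ n⟩ : Σ n m : ℕ, QCircuit cliffordT (n + m))) (t i)) ∧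
      ∀ x, (x ∈ L → 2 / 3 ≤ F.acceptProbOn 0 x) ∧ (x ∉ L → F.acceptProbOn 0 x ≤ 1 / 3) := by
  simp only [Set.mem_iUnion, mem_BQTimeUniform_iff]
  constructor
  · rintro ⟨i, F, hF, hT, hL⟩
    exact ⟨F, hF, ⟨i, hT⟩, hL⟩
  · rintro ⟨F, hF, ⟨i, hT⟩, hL⟩
    exact ⟨i, F, hF, hT, hL⟩

/-- The class of languages decided with error `≤ 1/3` by oracle-free Clifford+T families generated
in time `C·nᵏ + C` for SOME `C`, written as one comprehension (route `CompactnessLift`'s `QuadQ` is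
literally the case `k = 2`), is `⋃ C, BQTimeUniform (C·nᵏ + C)`. [folklore] -/
theorem setOf_exists_timeComputable_eq_iUnion (k : ℕ) :
    {L : Language Bool | ∃ F : QCircuitFamily cliffordT, F.IsOracleFree ∧
      (∃ C : ℕ, TimeComputable unaryEncodeNat (QCircuit.sigmaEncode (G := cliffordT))
        (fun n => (⟨n, F.ancillas n, F.circ n⟩ : Σ n m : ℕ, QCircuit cliffordT (n + m)))
        (fun n => C * n ^ k + C)) ∧
      ∀ x, (x ∈ L → 2 / 3 ≤ F.acceptProbOn 0 x) ∧ (x ∉ L → F.acceptProbOn 0 x ≤ 1 / 3)} =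
    ⋃ C : ℕ, BQTimeUniform (fun n => C * n ^ k + C) :=
  Set.ext fun _ => mem_iUnion_BQTimeUniform_iff.symm

/-- The same comprehension is contained in `BQP` (at `k = 2`: `QuadQ ⊆ BQP`, the sanity item
`QuadSubsetBQP` of route `CompactnessLift`). [cite: BernsteinVazirani1997SICOMP, §8.1 (BQP, BQTime(T(n)))] -/
theorem setOf_exists_timeComputable_pow_subset_BQP (k : ℕ) :
    {L : Language Bool | ∃ F : QCircuitFamily cliffordT, F.IsOracleFree ∧
      (∃ C : ℕ, TimeComputable unaryEncodeNat (QCircuit.sigmaEncode (G := cliffordT))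
        (fun n => (⟨n, F.ancillas n, F.circ n⟩ : Σ n m : ℕ, QCircuit cliffordT (n + m)))
        (fun n => C * n ^ k + C)) ∧
      ∀ x, (x ∈ L → 2 / 3 ≤ F.acceptProbOn 0 x) ∧ (x ∉ L → F.acceptProbOn 0 x ≤ 1 / 3)} ⊆ BQP := by
  rw [setOf_exists_timeComputable_eq_iUnion]
  exact iUnion_BQTimeUniform_mul_pow_add_subset_BQP k

end Literature.Computability.QuantumComplexity
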